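import Summits.BirchSwinnertonDyer.BirchSwinnertonDyer.Theses.ResidualThetaTransportAtTwo
import HarnessLib

/-!
# Route `ResidualThetaTransportAtTwo` (rung W-ALL/1.hab⁺): glue of the Kμ⁺ split (item stmt-BirchSwinnertonDyer-21440)

The route pen's glued split (tenure W-23(2), tribunal flag F-RTT-1 (a)) of crux Kμ⁺
`SignedMuVanishingAtTwoPlus` (stmt-BirchSwinnertonDyer-20689) into
`SignedMuAnalyticAtTwoPlus` (21437, analytic half: 2-adic unit coefficient of Kobayashi's `L⁺`),
`SignedMuSeedAtTwoPlus` (21438, the ONE conjecture-grade node: SOME a₂ = 0 good-supersingular `A/ℚ` (the CM theta partner on the 73-leaf habitat; `A := W` allowed)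
with `A[2] ≃ W[2]` Galois-equivariantly and `μ(X⁺(A)) = 0`) and
`SignedMuPropagationAtTwo` (21439, `μ⁺ = 0` is a `ρ̄`-invariant among a₂ = 0 supersingular curves at 2).
This file proves the glue item
`SignedMuVanishingAtTwoPlusGlue := SignedMuAnalyticAtTwoPlus → SignedMuSeedAtTwoPlus →
  SignedMuPropagationAtTwo → SignedMuVanishingAtTwoPlus`
by two lines of logic (seed, then propagate, for the algebraic conjunct; the analytic conjunct is
the first hypothesis verbatim). Nothing is asserted: the three children stay hypotheses. BSD is not
proved by this. [cite: Kobayashi2003, Thm 1.2/1.3; NuccioSujatha2019 (p odd template of the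
propagation)]
-/

set_option autoImplicit false
set_option linter.dupNamespace false

namespace Summit.BirchSwinnertonDyer.BirchSwinnertonDyer.Theorems

open Summit.BirchSwinnertonDyer.BirchSwinnertonDyer.Theses.ResidualThetaTransportAtTwo

/-- **Glue of the Kμ⁺ split holds** (item stmt-BirchSwinnertonDyer-21440): analytic half + seed +
propagation ⟹ `SignedMuVanishingAtTwoPlus`. -/
theorem signedMuVanishingAtTwoPlusGlue : SignedMuVanishingAtTwoPlusGlue := by
  intro hAn hSeed hProp W _ _ hCM hr hss ha hΔ
  refine ⟨?_, ?_⟩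
  · intro κ γ hκ hγ D _
    obtain ⟨A, hAell, hAmin, hssA, haA, hiso, hμA⟩ := hSeed W hCM hr hss ha hΔ
    exact hProp W A hss ha hssA haA hiso hμA κ γ hκ hγ D
  · intro γ hγ _ f hf ϖ hϖ Lplus Lminus hP G m hG
    exact hAn W hCM hr hss ha hΔ γ hγ f hf ϖ hϖ Lplus Lminus hP G m hG

end Summit.BirchSwinnertonDyer.BirchSwinnertonDyer.Theorems
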